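import Literature.Probability.Percolation.KozmaNitzanPreFKG
import Literature.Probability.Percolation.PlanarDuality
import HarnessLib

/-!
# `NoHeavyLowerTail` (stmt-CriticalPhenomena-4575) — Kozma–Nitzan Question 7 reduced to its `b`-free
# ("peeled") form, and the one-relay case of that form

Support file (`--supports stmt-CriticalPhenomena-4575`), coupling seat `prim-cplus-coupling` (gen 5).  No
definitions, no named facts, no sorries.

Kozma–Nitzan (arXiv:2401.12397) ask in Question 7 (p. 36) whether, for a finite relay set `A`, an observer
`o`, a target `b` and the relay `z ∈ A` minimising `P(z ↔ b)`, the pre-FKG inequality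
`P(o ↔ b, o ↔ A) ≥ P(z ↔ b, o ↔ A)` holds.  Write `{o ↔ A in G∖b} = ⋃_{a ∈ A} {o ↔ a in {b}ᶜ}` for the
event that the observer is joined to some relay by an open path AVOIDING `b`.

* `Q7Psi.q7_of_psi` — **the reduction** (pure event algebra, no hypothesis on `z`): if
  `P(z ↔ b, o ↔ A in G∖b) ≤ P(o ↔ b, o ↔ A in G∖b)` then `P(z ↔ b, o ↔ A) ≤ P(o ↔ b, o ↔ A)`.  Reason:
  on `{o ↔ A} ∖ {o ↔ A in G∖b}` every open path from `o` to a relay passes through `b`, so `o ↔ b`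
  holds there, and the difference of the two sides is `μ({o↔A} ∖ {o↔A in G∖b}) − μ({z↔b} ∩ ({o↔A} ∖ {o↔A in G∖b})) ≥ 0`.
  (Equivalently: conditioning on the connectivity of `G ∖ b`, `P(o ↔ b | ·) = u(C_o)` and `P(z ↔ b | ·) = u(C_z)`
  for the increasing set function `u(S) = 1 − ∏_{s ∈ S} (1 − w_{sb})`, and the hypothesis reads
  `E[(u(C_o) − u(C_z)); o ↔ A in G∖b] ≥ 0` — the form in which the seat's census found no violation.)
* `Q7Psi.psi_single` — **the one-relay case of the peeled form**: if `P(z ↔ b) ≤ P(x ↔ b)` then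
  `P(z ↔ b, o ↔ x in G∖b) ≤ P(x ↔ b, o ↔ x in G∖b)`: Kozma–Nitzan's Lemma 3(i) (tree theorem
  `KozmaNitzan2024_lemma3_i`) applied to the increasing event `{o ↔ x in {b}ᶜ}` of the cluster of `x`
  (`Q7Psi.mem_openConnIn_iff_of_cluster_subset`: the event is read off the open edge cluster `C_x`).
* `Q7Psi.q7_two_peeled` — the two together re-prove Question 7 for `A = {x, z}` (Kozma–Nitzan's Theorem 1)
  through the peeled form.
[cite: KozmaNitzan2024, Question 7 (p. 36), Lemma 3(i) (pp. 6–7), Theorem 1 (p. 7)]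
-/

namespace Summit.CriticalPhenomena.PercolationContinuityZ3.Theorems

open MeasureTheory Set Literature.Probability.LatticeModels Literature.Probability.Percolation
open scoped Classical

noncomputable section

namespace Q7Psi

variable {V : Type*}

/-- If `o` is joined to `a` by an open path but not by one avoiding `b`, then `o ↔ b`
(follow the path to its first visit of `b`). [folklore] -/
theorem reachable_of_not_openConnIn_compl {ω : BondConfig V} {o a b : V}
    (h : (openGraph ω).Reachable o a) (hn : ω ∉ openConnIn ({b}ᶜ : Set V) o a) :
    (openGraph ω).Reachable o b := by
  have h' : Relation.ReflTransGen (openGraph ω).Adj o a := (SimpleGraph.reachable_iff_reflTransGen _ _).1 h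
  -- along the path: either `o ↔ b` already, or `o ↔ v` inside `{b}ᶜ`
  have key : ∀ v : V, Relation.ReflTransGen (openGraph ω).Adj o v →
      (openGraph ω).Reachable o b ∨ ω ∈ openConnIn ({b}ᶜ : Set V) o v := by
    intro v hv
    induction hv with
    | refl =>
      by_cases hob : o = b
      · exact Or.inl (hob ▸ SimpleGraph.Reachable.refl _)
      · exact Or.inr (KNPreFKG.openConnIn_rfl (show o ∈ ({b}ᶜ : Set V) from hob) ω)
    | tail hoc hcd ih =>
      rename_i c d
      rcases ih with hb | hc
      · exact Or.inl hb
      · by_cases hdb : d = b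
        · subst hdb
          exact Or.inl ((KNPreFKG.reachable_of_openConnIn hc).trans hcd.reachable)
        · exact Or.inr (KNPreFKG.openConnIn_trans hc (KNPreFKG.openConnIn_of_adj hc.2.1 hdb hcd))
  rcases key a h' with hb | ha
  · exact hb
  · exact absurd ha hn

/-- The restricted connection event `{s ↔ a in S}` is read off any edge set between the open edge cluster
`C_s` and `ω`: if `C_s(ω) ⊆ E ⊆ ω` then `E ∈ {s ↔ a in S} ↔ ω ∈ {s ↔ a in S}`.
[cite: VandenbergHaggstromKahn2005, §1 p. 3 (events defined on the cluster)] -/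
theorem mem_openConnIn_iff_of_cluster_subset {ω E : BondConfig V} {S : Set V} {s a : V}
    (hE : openEdgeCluster ω s ⊆ E) (hEω : E ⊆ ω) :
    E ∈ (openConnIn S s a : Set (BondConfig V)) ↔ ω ∈ (openConnIn S s a : Set (BondConfig V)) := by
  constructor
  · intro h
    exact isUpperSet_openConnIn S s a hEω h
  · rintro ⟨hs, ha, hr⟩
    rw [SimpleGraph.reachable_iff_reflTransGen] at hr
    -- along the chain inside `S`, every pair used lies in `C_s(ω) ⊆ E`
    have key : ∀ v : S, Relation.ReflTransGen ((openGraph ω).induce S).Adj ⟨s, hs⟩ v →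
        (openGraph ω).Reachable s v.1 ∧ ((openGraph E).induce S).Reachable ⟨s, hs⟩ v := by
      intro v hv
      induction hv with
      | refl => exact ⟨SimpleGraph.Reachable.refl _, SimpleGraph.Reachable.refl _⟩
      | tail hsc hcd ih =>
        rename_i c d
        have hcd' : (openGraph ω).Adj c.1 d.1 := by
          simpa only [SimpleGraph.comap_adj, Function.Embedding.coe_subtype] using hcd
        have hmem : s(c.1, d.1) ∈ ω ∧ c.1 ≠ d.1 := (openGraph_adj ω c.1 d.1).1 hcd'
        have hsd : (openGraph ω).Reachable s d.1 := ih.1.trans hcd'.reachable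
        have hC : s(c.1, d.1) ∈ openEdgeCluster ω s := by
          refine (mem_openEdgeCluster_iff ω s _).2 ⟨hmem.1, ?_, ?_⟩
          · rw [Sym2.mk_isDiag_iff]
            exact hmem.2
          · intro v hv
            rcases Sym2.mem_iff.1 hv with rfl | rfl
            · exact ih.1
            · exact hsd
        have hadjE : ((openGraph E).induce S).Adj c d := by
          simp only [SimpleGraph.comap_adj, Function.Embedding.coe_subtype, openGraph_adj]
          exact ⟨hE hC, hmem.2⟩
        exact ⟨hsd, ih.2.trans hadjE.reachable⟩
    exact ⟨hs, ha, (key ⟨a, ha⟩ hr).2⟩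

variable [Fintype V]

/-- **Question 7 reduced to its peeled (`b`-free) form.**  For every finite relay set `A`, observer `o`,
target `b` and designated relay `z`: if `μ({z↔b} ∩ ⋃_{a∈A} {o ↔ a in {b}ᶜ}) ≤ μ({o↔b} ∩ ⋃_{a∈A} {o ↔ a in {b}ᶜ})`
then `μ({z↔b} ∩ {o↔A}) ≤ μ({o↔b} ∩ {o↔A})`.  No reliability hypothesis is needed for this step.
[cite: KozmaNitzan2024, Question 7 (p. 36)] -/
theorem q7_of_psi (w : Sym2 V → unitInterval) (o b z : V) (A : Finset V)
    (hΨ : (prodBernoulli w).real (openConn z b ∩ ⋃ a ∈ A, openConnIn ({b}ᶜ : Set V) o a) ≤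
      (prodBernoulli w).real (openConn o b ∩ ⋃ a ∈ A, openConnIn ({b}ᶜ : Set V) o a)) :
    (prodBernoulli w).real (openConn z b ∩ ⋃ a ∈ A, openConn o a) ≤
      (prodBernoulli w).real (openConn o b ∩ ⋃ a ∈ A, openConn o a) := by
  set μ := prodBernoulli w with hμ
  set J : Set (BondConfig V) := ⋃ a ∈ A, openConnIn ({b}ᶜ : Set V) o a with hJ
  set U : Set (BondConfig V) := ⋃ a ∈ A, (openConn o a : Set (BondConfig V)) with hU
  -- `J ⊆ U` and `U ∖ J ⊆ {o ↔ b}`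
  have hJU : J ⊆ U := by
    intro ω hω
    simp only [hJ, hU, mem_iUnion] at hω ⊢
    obtain ⟨a, ha, h⟩ := hω
    exact ⟨a, ha, KNPreFKG.reachable_of_openConnIn h⟩
  have hUJ : U \ J ⊆ (openConn o b : Set (BondConfig V)) := by
    rintro ω ⟨hωU, hωJ⟩
    simp only [hJ, hU, mem_iUnion] at hωU hωJ
    obtain ⟨a, ha, h⟩ := hωU
    have hn : ω ∉ openConnIn ({b}ᶜ : Set V) o a := fun h' => hωJ ⟨a, ha, h'⟩
    exact reachable_of_not_openConnIn_compl h hn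
  have msplit : ∀ X : Set (BondConfig V), μ.real (X ∩ U) = μ.real (X ∩ J) + μ.real (X ∩ (U \ J)) := by
    intro X
    have hdj : Disjoint (X ∩ J) (X ∩ (U \ J)) := by
      rw [Set.disjoint_left]
      rintro ω ⟨-, hωJ⟩ ⟨-, -, hωJ'⟩
      exact hωJ' hωJ
    rw [← measureReal_union hdj MeasurableSet.of_discrete]
    congr 1
    ext ω
    simp only [mem_inter_iff, mem_union, mem_sdiff]
    constructor
    · rintro ⟨hX, hωU⟩
      by_cases hωJ : ω ∈ J
      · exact Or.inl ⟨hX, hωJ⟩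
      · exact Or.inr ⟨hX, hωU, hωJ⟩
    · rintro (⟨hX, hωJ⟩ | ⟨hX, hωU, -⟩)
      · exact ⟨hX, hJU hωJ⟩
      · exact ⟨hX, hωU⟩
  have h1 : μ.real (openConn z b ∩ (U \ J)) ≤ μ.real (U \ J) := measureReal_mono inter_subset_right
  have h2 : μ.real (openConn o b ∩ (U \ J)) = μ.real (U \ J) := by
    congr 1
    exact inter_eq_right.2 hUJ
  rw [msplit (openConn z b), msplit (openConn o b), h2]
  linarith

/-- **The one-relay peeled inequality** (Kozma–Nitzan's Lemma 3(i) for the increasing cluster event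
`{o ↔ x in {b}ᶜ}`): if `μ(z ↔ b) ≤ μ(x ↔ b)` then `μ({z↔b} ∩ {o ↔ x in {b}ᶜ}) ≤ μ({x↔b} ∩ {o ↔ x in {b}ᶜ})`.
[cite: KozmaNitzan2024, Lemma 3(i) (pp. 6–7)] -/
theorem psi_single (w : Sym2 V → unitInterval) (o b x z : V)
    (hzx : (prodBernoulli w).real (openConn z b) ≤ (prodBernoulli w).real (openConn x b)) :
    (prodBernoulli w).real (openConn z b ∩ openConnIn ({b}ᶜ : Set V) o x) ≤
      (prodBernoulli w).real (openConn x b ∩ openConnIn ({b}ᶜ : Set V) o x) := by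
  set 𝒬 : Set (Set (Sym2 V)) := (openConnIn ({b}ᶜ : Set V) x o : Set (BondConfig V)) with h𝒬def
  have h𝒬 : IsUpperSet 𝒬 := isUpperSet_openConnIn _ x o
  have hev : {ω : BondConfig V | openEdgeCluster ω x ∈ 𝒬} = openConnIn ({b}ᶜ : Set V) o x := by
    rw [openConnIn_comm ({b}ᶜ : Set V) o x]
    ext ω
    exact mem_openConnIn_iff_of_cluster_subset subset_rfl (openEdgeCluster_subset ω x)
  have key := KozmaNitzan2024_lemma3_i w z x b le_rfl (by simpa using hzx) h𝒬
  rw [hev, zero_mul, add_zero] at key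
  exact key

/-- **Question 7 for two relays through the peeled form** (= Kozma–Nitzan's Theorem 1 for the less
reliable relay): if `μ(z↔b) ≤ μ(x↔b)` then `μ({z↔b} ∩ ({o↔x} ∪ {o↔z})) ≤ μ({o↔b} ∩ ({o↔x} ∪ {o↔z}))`.
Proof: `q7_of_psi` with `A = {x, z}`; in the peeled form the piece `{o ↔ z in {b}ᶜ}` contributes equally to
both sides (there `z ↔ b ⇔ o ↔ b`), and the piece `{o ↔ x in {b}ᶜ} ∖ {o ↔ z in {b}ᶜ}` is `psi_single`
minus that common part. [cite: KozmaNitzan2024, Theorem 1 (p. 7), Question 7 (p. 36)] -/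
theorem q7_two_peeled (w : Sym2 V → unitInterval) (o b x z : V)
    (hzx : (prodBernoulli w).real (openConn z b) ≤ (prodBernoulli w).real (openConn x b)) :
    (prodBernoulli w).real (openConn z b ∩ (openConn o x ∪ openConn o z)) ≤
      (prodBernoulli w).real (openConn o b ∩ (openConn o x ∪ openConn o z)) := by
  set μ := prodBernoulli w with hμ
  have hA : ∀ X : Set (BondConfig V), X ∩ (⋃ a ∈ ({x, z} : Finset V), (openConn o a : Set (BondConfig V))) =
      X ∩ (openConn o x ∪ openConn o z) := by
    intro X; congr 1; ext ω; simp
  have hred := q7_of_psi w o b z ({x, z} : Finset V)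
  rw [hA, hA] at hred
  refine hred ?_
  -- the peeled inequality for `A = {x, z}`
  set Jx : Set (BondConfig V) := openConnIn ({b}ᶜ : Set V) o x with hJx
  set Jz : Set (BondConfig V) := openConnIn ({b}ᶜ : Set V) o z with hJz
  have hJ : ∀ X : Set (BondConfig V), X ∩ (⋃ a ∈ ({x, z} : Finset V), openConnIn ({b}ᶜ : Set V) o a) =
      X ∩ (Jx ∪ Jz) := by
    intro X; congr 1; ext ω; simp [hJx, hJz]
  rw [hJ, hJ]
  -- split `Jx ∪ Jz = (Jx ∖ Jz) ⊔ Jz`; on `Jz`, `z ↔ b ⇔ o ↔ b`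
  have hz_eq : openConn z b ∩ Jz = openConn o b ∩ Jz := by
    ext ω
    simp only [mem_inter_iff]
    constructor
    · rintro ⟨hzb, hJ⟩
      exact ⟨(KNPreFKG.reachable_of_openConnIn hJ).trans hzb, hJ⟩
    · rintro ⟨hob, hJ⟩
      exact ⟨(KNPreFKG.reachable_of_openConnIn hJ).symm.trans hob, hJ⟩
  have msplit : ∀ X : Set (BondConfig V), μ.real (X ∩ (Jx ∪ Jz)) = μ.real (X ∩ Jx ∩ Jzᶜ) + μ.real (X ∩ Jz) := by
    intro X
    have hdj : Disjoint (X ∩ Jx ∩ Jzᶜ) (X ∩ Jz) := by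
      rw [Set.disjoint_left]
      rintro ω ⟨-, hn⟩ ⟨-, hJ⟩
      exact hn hJ
    rw [← measureReal_union hdj MeasurableSet.of_discrete]
    congr 1
    ext ω
    simp only [mem_inter_iff, mem_union, mem_compl_iff]
    constructor
    · rintro ⟨hX, hJ | hJ⟩
      · by_cases h : ω ∈ Jz
        · exact Or.inr ⟨hX, h⟩
        · exact Or.inl ⟨⟨hX, hJ⟩, h⟩
      · exact Or.inr ⟨hX, hJ⟩
    · rintro (⟨⟨hX, hJ⟩, -⟩ | ⟨hX, hJ⟩)
      · exact ⟨hX, Or.inl hJ⟩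
      · exact ⟨hX, Or.inr hJ⟩
  -- on `Jx ∩ Jz`, again `z ↔ b ⇔ o ↔ b`, so `psi_single` passes to `Jx ∖ Jz`
  have hxz_eq : openConn z b ∩ Jx ∩ Jz = openConn o b ∩ Jx ∩ Jz := by
    rw [inter_assoc, inter_comm Jx Jz, ← inter_assoc, hz_eq, inter_assoc, inter_comm Jz Jx, ← inter_assoc]
  have m2 : ∀ X : Set (BondConfig V), μ.real (X ∩ Jx) = μ.real (X ∩ Jx ∩ Jz) + μ.real (X ∩ Jx ∩ Jzᶜ) := by
    intro X
    rw [← measureReal_inter_add_sdiff (μ := μ) (s := X ∩ Jx) (MeasurableSet.of_discrete : MeasurableSet Jz), sdiff_eq]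
  have hsingle := psi_single w o b x z hzx
  -- `{x ↔ b} ∩ Jx ⊆ {o ↔ b} ∩ Jx`
  have hxo : μ.real (openConn x b ∩ Jx) ≤ μ.real (openConn o b ∩ Jx) := by
    refine measureReal_mono ?_
    rintro ω ⟨hxb, hJ⟩
    exact ⟨(KNPreFKG.reachable_of_openConnIn hJ).trans hxb, hJ⟩
  have e1 := m2 (openConn z b)
  have e2 := m2 (openConn o b)
  rw [msplit, msplit, hz_eq]
  rw [hxz_eq] at e1
  linarith
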